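import Literature.NumberTheory.NumberFields.ArithmeticEquivalenceProofs
import Literature.NumberTheory.NumberFields.GassmannSmallIndex
import Literature.NumberTheory.NumberFields.BauerSplitPrimes
import Literature.NumberTheory.GaloisRepresentations.DegreeOnePrimesFixedField
import Mathlib.FieldTheory.IsAlgClosed.AlgebraicClosure
import Mathlib.FieldTheory.Galois.Basic
import HarnessLib

/-!
# Perlis 1977, Theorem 3, proved: number fields of degree `≤ 6` are solitary

Topic `NumberTheory/NumberFields` (namespace `Literature.NumberTheory.NumberFields`). Theorem-only
companion of `ArithmeticEquivalence.lean` (no definition, no named fact; D-0026) DISCHARGING the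
named fact `Perlis1977_thm3` (`Perlis1977_thm3_holds`), following the printed proof
[Perlis1977, §1 and §4] (sibling files: `ArithmeticEquivalenceProofs` — (a) ⇔ (b) and the degree
clause of Theorem 1 —, `ArithmeticEquivalenceGassmannProofs` — (d) ⇒ (b)):

1. `(c) ⇒ (d)` of Perlis's Theorem 1 (`isGassmannEquivalent_of_eventually_splittingType_eq`):
   for `x ∈ G = Gal(N/ℚ)` the tree's (unconditional) Chebotarev existence theorem
   `infinite_setOf_exists_isArithFrobAt` (`BauerSplitPrimes`) gives unramified `p` with a prime
   `Q ∣ p` of `N` of Frobenius `x`; by `DegreeOnePrimes.card_mul_card_absNorm_eq_card_conj_mem`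
   (`GaloisRepresentations/DegreeOnePrimesFixedField`) the number of `1`'s in the splitting type of
   `p` in `K = N^H` is `#{g : g x g⁻¹ ∈ H} / #H = #C_G(x) · #(x^G ∩ H) / #H`
   (`Gassmann.card_conj_mem_eq`), and `#H = #H'` by `finrank_eq_of_eventually_splittingType_eq`
   (file `ArithmeticEquivalenceProofs`).
2. Gassmann equivalent subgroups of index `≤ 6` are conjugate
   (`IsGassmannEquivalent.exists_eq_map_conj`, file `GassmannSmallIndex`; [Perlis1977, Thm. 3 / §4]).
3. Conjugate subgroups have conjugate fixed fields (`fixedField_map_conj`), so `K ≅ K'`, inside a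
   common finite Galois extension (`exists_isGalois_algHom₂`, Galois closure inside `ℚ̄`).

Also proved: `algEquiv_of_eventually_splittingType_eq` (hypothesis (c) instead of (b)) and the
UNCONDITIONAL norms form `algEquiv_of_eventually_splittingNorms_eq` of the consumer's conditional
`Perlis1977_thm3.algEquiv_of_splittingNorms` (route Langlands/E8QuinticResidue).

## Design notes

* The `ℚ`-algebra diamond (`DivisionRing.toRatAlgebra` versus the structural algebra of
  `AlgebraicClosure ℚ` and of its intermediate fields; with the tree's imports the former is found
  first) is confined to `exists_isGalois_algHom₂`, where `IsAlgClosure`, `IsGalois` and the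
  embeddings are transported along `Subsingleton (Algebra ℚ _)` (`isGalois_of_algebra_eq` etc.).
* Rational primes appear in two dialects in the tree (`HeightOneSpectrum (𝓞 ℚ)`/`IsArithFrobAt (𝓞 ℚ)`
  in `BauerSplitPrimes`; `Ideal.span {(p : ℤ)}`/`IsArithFrobAt ℤ` in `DegreeOnePrimesFixedField`);
  §`RatPrimes` translates (`p ∈ Q` characterises both `LiesOver` conditions).

## References

* [Perlis1977] R. Perlis, *On the equation `ζ_K(s) = ζ_{K'}(s)`*, J. Number Theory 9 (1977),
  342–360: §1 (Theorem 1, (c) ⇒ (d) via Frobenius density and Lemma 1), §4 (Theorem 3).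
* J. Neukirch, *Algebraic Number Theory*, Springer 1999, VII (13.4) and I §9 (the sources of the
  tree files `BauerSplitPrimes`, `DegreeOnePrimesFixedField`).
-/

noncomputable section
namespace Literature.NumberTheory.NumberFields

open Ideal UniqueFactorizationMonoid NumberField Filter IsDedekindDomain
open Literature.NumberTheory.GaloisRepresentations

/-! ### Degree-one primes and the splitting type -/

section Degree

variable {K : Type*} [Field K] [NumberField K]

/-- The number of `1`'s in the splitting type of `p` is the number of primes of `K` above `p` of
residue degree one. [folklore] -/
theorem count_one_splittingType (p : ℕ) [hp : Fact p.Prime] :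
    (splittingType K p).count 1 =
      Nat.card {P : (Ideal.span {(p : ℤ)}).primesOver (𝓞 K) // P.1.inertiaDeg ℤ = 1} := by
  classical
  set nf := normalizedFactors (span {(p : 𝓞 K)}) with hnf
  have hmem : ∀ P : Ideal (𝓞 K),
      P ∈ nf.toFinset ↔ P ∈ (Ideal.span {(p : ℤ)}).primesOver (𝓞 K) := by
    intro P
    rw [Multiset.mem_toFinset, hnf, mem_normalizedFactors_span_iff hp.out]
    rfl
  have h1 : (splittingType K p).count 1 = (nf.toFinset.filter fun P => P.inertiaDeg ℤ = 1).card := by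
    rw [splittingType, Multiset.count_map, ← hnf, Finset.card_def, Finset.filter_val,
      Multiset.toFinset_val]
    congr 1
    exact Multiset.filter_congr fun P _ => eq_comm
  rw [h1, ← Nat.card_eq_finsetCard]
  refine Nat.card_congr
    { toFun := fun P => ⟨⟨P.1, (hmem P.1).mp (Finset.mem_filter.mp P.2).1⟩,
        (Finset.mem_filter.mp P.2).2⟩
      invFun := fun P => ⟨P.1.1, Finset.mem_filter.mpr ⟨(hmem P.1.1).mpr P.1.2, P.2⟩⟩
      left_inv := fun P => rfl
      right_inv := fun P => rfl }

end Degree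

/-! ### Rational primes in the two dialects (`ℤ` and `𝓞 ℚ`) -/

section RatPrimes

/-- A rational prime `p` is a prime element of `𝓞 ℚ ≅ ℤ`. [folklore] -/
theorem prime_natCast_ringOfIntegers_rat {p : ℕ} (hp : p.Prime) : Prime (p : 𝓞 ℚ) := by
  have h : Rat.ringOfIntegersEquiv.symm (p : ℤ) = (p : 𝓞 ℚ) := map_natCast _ p
  rw [← h, MulEquiv.prime_iff]
  exact Nat.prime_iff_prime_int.mp hp

/-- A prime of `𝓞 ℚ` of norm `p` is the ideal `(p)`. [folklore] -/
theorem HeightOneSpectrum.asIdeal_eq_span_of_absNorm_eq {q : HeightOneSpectrum (𝓞 ℚ)} {p : ℕ}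
    (hp : p.Prime) (hq : absNorm q.asIdeal = p) : q.asIdeal = Ideal.span {(p : 𝓞 ℚ)} := by
  have hmem : (p : 𝓞 ℚ) ∈ q.asIdeal := by
    have := Ideal.absNorm_mem q.asIdeal
    rwa [hq] at this
  exact ((prime_natCast_ringOfIntegers_rat hp).isMaximal_span_singleton.eq_of_le
    q.isPrime.ne_top ((Ideal.span_singleton_le_iff_mem _).mpr hmem)).symm

variable {N : Type*} [Field N] [NumberField N]

/-- For a prime `Q` of `𝓞 N` and a prime `q` of `𝓞 ℚ` of norm `p`: `Q` lies over `q` iff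
`p ∈ Q`. [folklore] -/
theorem liesOver_heightOneSpectrum_rat_iff {q : HeightOneSpectrum (𝓞 ℚ)} {p : ℕ} (hp : p.Prime)
    (hq : absNorm q.asIdeal = p) {Q : Ideal (𝓞 N)} (hQ : Q ≠ ⊤) :
    Q.LiesOver q.asIdeal ↔ (p : 𝓞 N) ∈ Q := by
  rw [HeightOneSpectrum.asIdeal_eq_span_of_absNorm_eq hp hq,
    Ideal.liesOver_span_iff hQ (prime_natCast_ringOfIntegers_rat hp), map_natCast]

omit [NumberField N] in
/-- For a prime `Q` of `𝓞 N`: `Q` lies over `pℤ` iff `p ∈ Q`. [folklore] -/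
theorem liesOver_span_int_iff {p : ℕ} (hp : p.Prime) {Q : Ideal (𝓞 N)} (hQ : Q ≠ ⊤) :
    Q.LiesOver (Ideal.span {(p : ℤ)}) ↔ (p : 𝓞 N) ∈ Q := by
  rw [Ideal.liesOver_span_iff hQ (Nat.prime_iff_prime_int.mp hp), map_natCast]

/-- An arithmetic Frobenius over `𝓞 ℚ` at a prime above `q` (of norm `p`) is an arithmetic
Frobenius over `ℤ` (both mean `σ y ≡ y^p`). [folklore] -/
theorem isArithFrobAt_int_of_rat {q : HeightOneSpectrum (𝓞 ℚ)} {p : ℕ} (hp : p.Prime)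
    (hq : absNorm q.asIdeal = p) {Q : Ideal (𝓞 N)} (hQ : Q ∈ q.asIdeal.primesOver (𝓞 N))
    {σ : N ≃ₐ[ℚ] N} (hσ : IsArithFrobAt (𝓞 ℚ) σ Q) : IsArithFrobAt ℤ σ Q := by
  haveI := hQ.1
  have hQp : (p : 𝓞 N) ∈ Q := (liesOver_heightOneSpectrum_rat_iff hp hq hQ.1.ne_top).mp hQ.2
  haveI : Q.LiesOver (Ideal.span {(p : ℤ)}) := (liesOver_span_int_iff hp hQ.1.ne_top).mpr hQp
  have hcardO : Nat.card (𝓞 ℚ ⧸ Q.under (𝓞 ℚ)) = p := by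
    rw [← hQ.2.over, ← Submodule.cardQuot_apply, ← Ideal.absNorm_apply, hq]
  intro y
  have h1 := hσ y
  rw [hcardO] at h1
  rw [DegreeOnePrimes.card_int_quot_under p Q]
  exact h1

end RatPrimes

/-! ### (c) ⇒ (d) of Perlis's Theorem 1: Gassmann equivalence from splitting types -/

section Gassmann

/-- **Perlis 1977, Theorem 1, (c) ⇒ (d).** Let `N/ℚ` be a finite Galois extension containing
(the images of) the number fields `K` and `K'`. If `K` and `K'` have the same splitting type at all
but finitely many primes, then `H = Gal(N/K)` and `H' = Gal(N/K')` are Gassmann equivalent in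
`G = Gal(N/ℚ)`. Proof as in [Perlis1977, §1]: for `x ∈ G`, Chebotarev/Frobenius density
(the tree's `infinite_setOf_exists_isArithFrobAt`, `BauerSplitPrimes`) gives an unramified prime
`p` (outside the exceptional set) with a prime `Q ∣ p` of `N` whose Frobenius is `x`; the number
of degree-one primes of `K` above `p` — the number of `1`'s in the splitting type — is then
`#{g : g x g⁻¹ ∈ H} / #H = #C_G(x) · #(x^G ∩ H) / #H`
(`DegreeOnePrimes.card_mul_card_absNorm_eq_card_conj_mem`, `Gassmann.card_conj_mem_eq`), and
`#H = #H'` because the degrees agree. [cite: Perlis1977, Thm. 1 ((c) ⇒ (d), pp. 344–346)] -/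
theorem isGassmannEquivalent_of_eventually_splittingType_eq {K K' N : Type} [Field K]
    [NumberField K] [Field K'] [NumberField K'] [Field N] [NumberField N] [IsGalois ℚ N]
    (i : K →ₐ[ℚ] N) (i' : K' →ₐ[ℚ] N)
    (h : ∀ᶠ p : ℕ in cofinite, p.Prime → splittingType K p = splittingType K' p) :
    IsGassmannEquivalent i.fieldRange.fixingSubgroup i'.fieldRange.fixingSubgroup := by
  classical
  intro x
  set E : IntermediateField ℚ N := i.fieldRange with hE
  set E' : IntermediateField ℚ N := i'.fieldRange with hE'
  haveI : NumberField E := NumberField.of_module_finite ℚ E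
  haveI : NumberField E' := NumberField.of_module_finite ℚ E'
  -- splitting types of `E ≅ K`, `E' ≅ K'`
  have hEK : ∀ p : ℕ, p.Prime → splittingType E p = splittingType K p := fun p hp =>
    (splittingType_eq_of_ringEquiv
      (NumberField.RingOfIntegers.mapRingEquiv i.equivFieldRange.toRingEquiv) hp).symm
  have hE'K' : ∀ p : ℕ, p.Prime → splittingType E' p = splittingType K' p := fun p hp =>
    (splittingType_eq_of_ringEquiv
      (NumberField.RingOfIntegers.mapRingEquiv i'.equivFieldRange.toRingEquiv) hp).symm
  have hcount : ∀ᶠ p : ℕ in cofinite, p.Prime →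
      (splittingType E p).count 1 = (splittingType E' p).count 1 :=
    h.mono fun p hp hpp => by rw [hEK p hpp, hE'K' p hpp, hp hpp]
  -- `#H = #H'`
  have hHH' : Nat.card E.fixingSubgroup = Nat.card E'.fixingSubgroup := by
    rw [IsGalois.card_fixingSubgroup_eq_finrank E, IsGalois.card_fixingSubgroup_eq_finrank E']
    have e1 := Module.finrank_mul_finrank ℚ E N
    have e2 := Module.finrank_mul_finrank ℚ E' N
    rw [← i.equivFieldRange.toLinearEquiv.finrank_eq] at e1
    rw [← i'.equivFieldRange.toLinearEquiv.finrank_eq,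
      ← finrank_eq_of_eventually_splittingType_eq h] at e2
    exact Nat.eq_of_mul_eq_mul_left Module.finrank_pos (e1.trans e2.symm)
  -- a good prime: Frobenius `x`, unramified, outside the exceptional set
  have hS := infinite_setOf_exists_isArithFrobAt (F := ℚ) (L := N) x
  have hB : {p : ℕ | ¬ (p.Prime →
      (splittingType E p).count 1 = (splittingType E' p).count 1)}.Finite :=
    Filter.eventually_cofinite.mp hcount
  have hbad : {q : HeightOneSpectrum (𝓞 ℚ) | absNorm q.asIdeal ∈ {p : ℕ | ¬ (p.Prime →
      (splittingType E p).count 1 = (splittingType E' p).count 1)}}.Finite := by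
    have : {q : HeightOneSpectrum (𝓞 ℚ) | absNorm q.asIdeal ∈ {p : ℕ | ¬ (p.Prime →
        (splittingType E p).count 1 = (splittingType E' p).count 1)}} =
        ⋃ p ∈ {p : ℕ | ¬ (p.Prime →
          (splittingType E p).count 1 = (splittingType E' p).count 1)},
          {q : HeightOneSpectrum (𝓞 ℚ) | absNorm q.asIdeal = p} := by
      ext q; simp
    rw [this]
    refine hB.biUnion fun p _ => ?_
    exact (Ideal.finite_setOf_absNorm_eq (S := 𝓞 ℚ) p).preimage
      (fun a _ b _ hab => HeightOneSpectrum.ext hab)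
  obtain ⟨q, ⟨hqprime, hunr, Q, hQ, hfrob⟩, hqgood⟩ := (hS.sdiff hbad).nonempty
  set p : ℕ := absNorm q.asIdeal with hpdef
  haveI hpF : Fact p.Prime := ⟨hqprime⟩
  have hcnt : (splittingType E p).count 1 = (splittingType E' p).count 1 := by
    simp only [Set.mem_setOf_eq, Classical.not_imp] at hqgood
    push Not at hqgood
    exact hqgood hqprime
  -- move to the `ℤ`-dialect of `DegreeOnePrimesFixedField`
  haveI := hQ.1
  have hpQ : (p : 𝓞 N) ∈ Q := (liesOver_heightOneSpectrum_rat_iff hqprime rfl hQ.1.ne_top).mp hQ.2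
  haveI : Q.LiesOver (Ideal.span {(p : ℤ)}) := (liesOver_span_int_iff hqprime hQ.1.ne_top).mpr hpQ
  have hunr' : ∀ Q' : Ideal (𝓞 N), Q'.IsPrime → Q'.LiesOver (Ideal.span {(p : ℤ)}) →
      Q'.inertia (N ≃ₐ[ℚ] N) = ⊥ := fun Q' hQ'1 hQ'2 =>
    inertia_eq_bot_of_isUnramifiedIn hunr ⟨hQ'1,
      (liesOver_heightOneSpectrum_rat_iff hqprime rfl hQ'1.ne_top).mpr
        ((liesOver_span_int_iff hqprime hQ'1.ne_top).mp hQ'2)⟩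
  have hF : IsArithFrobAt ℤ x Q := isArithFrobAt_int_of_rat hqprime rfl hQ hfrob
  haveI : IsGaloisGroup E.fixingSubgroup E N := IsGaloisGroup.intermediateField (N ≃ₐ[ℚ] N) ℚ N E
  haveI : IsGaloisGroup E'.fixingSubgroup E' N :=
    IsGaloisGroup.intermediateField (N ≃ₐ[ℚ] N) ℚ N E'
  have cE := DegreeOnePrimes.card_mul_card_absNorm_eq_card_conj_mem p E E.fixingSubgroup Q hunr' hF
  have cE' := DegreeOnePrimes.card_mul_card_absNorm_eq_card_conj_mem p E' E'.fixingSubgroup Q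
    hunr' hF
  rw [DegreeOnePrimes.card_absNorm_eq_card_inertiaDeg_eq_one p E, ← count_one_splittingType,
    Gassmann.card_conj_mem_eq] at cE
  rw [DegreeOnePrimes.card_absNorm_eq_card_inertiaDeg_eq_one p E', ← count_one_splittingType,
    Gassmann.card_conj_mem_eq, ← hcnt, ← hHH', cE] at cE'
  exact Nat.eq_of_mul_eq_mul_left Nat.card_pos cE'

/-- **Perlis 1977, Theorem 1, (b) ⇒ (d)**: arithmetically equivalent fields have Gassmann
equivalent groups in any common finite Galois extension. [cite: Perlis1977, Thm. 1 ((b) ⇒ (d))] -/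
theorem ArithmeticallyEquivalent.isGassmannEquivalent {K K' N : Type} [Field K] [NumberField K]
    [Field K'] [NumberField K'] [Field N] [NumberField N] [IsGalois ℚ N]
    (i : K →ₐ[ℚ] N) (i' : K' →ₐ[ℚ] N) (h : ArithmeticallyEquivalent K K') :
    IsGassmannEquivalent i.fieldRange.fixingSubgroup i'.fieldRange.fixingSubgroup :=
  isGassmannEquivalent_of_eventually_splittingType_eq i i' (Eventually.of_forall h)

end Gassmann

/-! ### A common Galois extension, and conjugate fixed fields -/

section Galois

/-- Transport of `Algebra.IsAlgebraic` along an equality of algebra structures. [folklore] -/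
theorem isAlgebraic_of_algebra_eq {F L : Type*} [Field F] [Field L] {A : Algebra F L}
    (B : Algebra F L) (h : A = B) (hA : @Algebra.IsAlgebraic F L _ _ A) :
    @Algebra.IsAlgebraic F L _ _ B := by
  subst h; exact hA

/-- Transport of `IsGalois` along an equality of algebra structures. [folklore] -/
theorem isGalois_of_algebra_eq {F L : Type*} [Field F] [Field L] {A : Algebra F L}
    (B : Algebra F L) (h : A = B) (hA : @IsGalois F _ L _ A) : @IsGalois F _ L _ B := by
  subst h; exact hA

/-- Transport of an algebra homomorphism along an equality of algebra structures on the target.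
[folklore] -/
theorem nonempty_algHom_of_algebra_eq {F K L : Type*} [Field F] [Field K] [Field L] [Algebra F K]
    {A : Algebra F L} (B : Algebra F L) (h : A = B) (f : @AlgHom F K L _ _ _ _ A) :
    Nonempty (@AlgHom F K L _ _ _ _ B) := by
  subst h; exact ⟨f⟩

/-- Two number fields embed into a common finite Galois extension of `ℚ` (the Galois closure of
their compositum inside `ℚ̄`). The structural `ℚ`-algebra structures of `AlgebraicClosure ℚ` and
of its intermediate fields are realigned with the canonical `DivisionRing.toRatAlgebra` through
`Subsingleton (Algebra ℚ _)`. [folklore] -/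
theorem exists_isGalois_algHom₂ (K K' : Type) [Field K] [NumberField K] [Field K']
    [NumberField K'] :
    ∃ (N : Type) (_ : Field N) (_ : NumberField N) (_ : IsGalois ℚ N),
      Nonempty (K →ₐ[ℚ] N) ∧ Nonempty (K' →ₐ[ℚ] N) := by
  -- `ℚ̄` is an algebraic closure of `ℚ` also for the canonical `ℚ`-algebra structure
  haveI : IsAlgClosure ℚ (AlgebraicClosure ℚ) :=
    ⟨inferInstance, isAlgebraic_of_algebra_eq _ (Subsingleton.elim _ _)
      (AlgebraicClosure.isAlgebraic ℚ)⟩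
  let i₀ : K →ₐ[ℚ] AlgebraicClosure ℚ := IsAlgClosed.lift
  let i₀' : K' →ₐ[ℚ] AlgebraicClosure ℚ := IsAlgClosed.lift
  haveI : FiniteDimensional ℚ i₀.fieldRange := i₀.equivFieldRange.toLinearEquiv.finiteDimensional
  haveI : FiniteDimensional ℚ i₀'.fieldRange :=
    i₀'.equivFieldRange.toLinearEquiv.finiteDimensional
  let E₀ : IntermediateField ℚ (AlgebraicClosure ℚ) := i₀.fieldRange ⊔ i₀'.fieldRange
  let N : IntermediateField ℚ (AlgebraicClosure ℚ) :=
    IntermediateField.normalClosure ℚ E₀ (AlgebraicClosure ℚ)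
  have hG : IsGalois ℚ N := IsGalois.normalClosure ℚ E₀ (AlgebraicClosure ℚ)
  haveI : NumberField N := NumberField.of_module_finite ℚ N
  refine ⟨N, inferInstance, inferInstance, isGalois_of_algebra_eq _ (Subsingleton.elim _ _) hG,
    ?_, ?_⟩
  · exact nonempty_algHom_of_algebra_eq _ (Subsingleton.elim _ _) ((IntermediateField.inclusion
      ((le_sup_left : i₀.fieldRange ≤ E₀).trans (IntermediateField.le_normalClosure E₀))).comp
      i₀.equivFieldRange.toAlgHom)
  · exact nonempty_algHom_of_algebra_eq _ (Subsingleton.elim _ _) ((IntermediateField.inclusion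
      ((le_sup_right : i₀'.fieldRange ≤ E₀).trans (IntermediateField.le_normalClosure E₀))).comp
      i₀'.equivFieldRange.toAlgHom)

end Galois

section GaloisConj

variable {F L : Type*} [Field F] [Field L] [Algebra F L]

/-- **Fixed fields of conjugate subgroups are conjugate**: `L^{gHg⁻¹} = g(L^H)`. [folklore] -/
theorem fixedField_map_conj (H : Subgroup (L ≃ₐ[F] L)) (g : L ≃ₐ[F] L) :
    IntermediateField.fixedField (H.map (MulAut.conj g).toMonoidHom) =
      (IntermediateField.fixedField H).map (g : L →ₐ[F] L) := by
  ext y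
  rw [IntermediateField.mem_fixedField_iff, IntermediateField.mem_map]
  constructor
  · intro hy
    refine ⟨g.symm y, ?_, g.apply_symm_apply y⟩
    rw [IntermediateField.mem_fixedField_iff]
    intro f hf
    have h1 : (g * f * g⁻¹) y = y :=
      hy _ (Subgroup.mem_map.mpr ⟨f, hf, rfl⟩)
    rw [AlgEquiv.mul_apply, AlgEquiv.mul_apply, AlgEquiv.aut_inv] at h1
    calc f (g.symm y) = g.symm (g (f (g.symm y))) := (g.symm_apply_apply _).symm
      _ = g.symm y := by rw [h1]
  · rintro ⟨z, hz, rfl⟩ f' hf'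
    obtain ⟨f, hf, rfl⟩ := Subgroup.mem_map.mp hf'
    rw [IntermediateField.mem_fixedField_iff] at hz
    show (g * f * g⁻¹) (g z) = g z
    rw [AlgEquiv.mul_apply, AlgEquiv.mul_apply, AlgEquiv.aut_inv, g.symm_apply_apply, hz f hf]

end GaloisConj

/-! ### Perlis's Theorem 3 -/

section Thm3

/-- **Number fields of degree `≤ 6` with the same splitting types at almost all primes are
isomorphic** ((c) ⇒ (d) of Theorem 1, then Theorem 3: Gassmann equivalent subgroups of index
`≤ 6` are conjugate, `IsGassmannEquivalent.exists_eq_map_conj`, and conjugate subgroups have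
conjugate, hence isomorphic, fixed fields). [cite: Perlis1977, Thm. 3 with Thm. 1 ((c) ⇒ (d))] -/
theorem algEquiv_of_eventually_splittingType_eq {K K' : Type} [Field K] [NumberField K]
    [Field K'] [NumberField K'] (hdeg : Module.finrank ℚ K ≤ 6)
    (h : ∀ᶠ p : ℕ in cofinite, p.Prime → splittingType K p = splittingType K' p) :
    Nonempty (K ≃ₐ[ℚ] K') := by
  obtain ⟨N, _, _, _, ⟨i⟩, ⟨i'⟩⟩ := exists_isGalois_algHom₂ K K'
  have hG := isGassmannEquivalent_of_eventually_splittingType_eq i i' h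
  set E : IntermediateField ℚ N := i.fieldRange with hE
  set E' : IntermediateField ℚ N := i'.fieldRange with hE'
  have hidx : E.fixingSubgroup.index ≤ 6 := by
    have h1 := E.fixingSubgroup.card_mul_index
    rw [IsGalois.card_fixingSubgroup_eq_finrank E, IsGalois.card_aut_eq_finrank,
      ← Module.finrank_mul_finrank ℚ E N, mul_comm] at h1
    rw [Nat.eq_of_mul_eq_mul_right Module.finrank_pos h1,
      i.equivFieldRange.toLinearEquiv.finrank_eq.symm]  -- hmm
    exact hdeg
  obtain ⟨g, hg⟩ := hG.exists_eq_map_conj hidx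
  have hfix : E' = E.map (g : N →ₐ[ℚ] N) := by
    rw [← IsGalois.fixedField_fixingSubgroup E', hg, fixedField_map_conj,
      IsGalois.fixedField_fixingSubgroup]
  exact ⟨(i.equivFieldRange.trans ((IntermediateField.equivMap E (g : N →ₐ[ℚ] N)).trans
    (IntermediateField.equivOfEq hfix.symm))).trans i'.equivFieldRange.symm⟩

/-- **Perlis 1977, Theorem 3 — DISCHARGED.** A number field of degree `≤ 6` is solitary: it is
isomorphic to every arithmetically equivalent field. [cite: Perlis1977, Thm. 3 (p. 355)] -/
theorem Perlis1977_thm3_holds : Perlis1977_thm3 := fun _ _ _ _ _ _ hdeg h =>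
  algEquiv_of_eventually_splittingType_eq hdeg (Eventually.of_forall h)

/-- **The consumer's rendering, unconditionally** (route Langlands/E8QuinticResidue, crux
`NoChimeras`): if `[K : ℚ] ≤ 6` and the multisets of norms of the prime factors of `p𝓞 K` and of
`p𝓞 K'` coincide for all but finitely many primes `p`, then `K ≅ K'` over `ℚ`
(cf. the conditional `Perlis1977_thm3.algEquiv_of_splittingNorms`).
[cite: Perlis1977, Thm. 1 ((c) ⇒ (d)) and Thm. 3] -/
theorem algEquiv_of_eventually_splittingNorms_eq {K K' : Type} [Field K] [NumberField K]
    [Field K'] [NumberField K'] (hdeg : Module.finrank ℚ K ≤ 6)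
    (h : ∀ᶠ p : ℕ in cofinite, p.Prime → splittingNorms K p = splittingNorms K' p) :
    Nonempty (K ≃ₐ[ℚ] K') :=
  algEquiv_of_eventually_splittingType_eq hdeg (eventually_splittingType_eq_of_splittingNorms h)

/-- Symmetric variant with the degree bound on `K'`. [cite: Perlis1977, Thm. 1 and Thm. 3] -/
theorem algEquiv_of_eventually_splittingNorms_eq' {K K' : Type} [Field K] [NumberField K]
    [Field K'] [NumberField K'] (hdeg : Module.finrank ℚ K' ≤ 6)
    (h : ∀ᶠ p : ℕ in cofinite, p.Prime → splittingNorms K p = splittingNorms K' p) :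
    Nonempty (K ≃ₐ[ℚ] K') := by
  have h' : ∀ᶠ p : ℕ in cofinite, p.Prime → splittingNorms K' p = splittingNorms K p :=
    h.mono fun p hp hpp => (hp hpp).symm
  obtain ⟨e⟩ := algEquiv_of_eventually_splittingNorms_eq hdeg h'
  exact ⟨e.symm⟩

end Thm3

end Literature.NumberTheory.NumberFields
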